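import Literature.AnabelianGeometry.SemiGraphs.CoveringGraphHereditary
import Literature.AnabelianGeometry.SemiGraphs.UniversalCoveringOverGaloisObj
import Literature.AnabelianGeometry.SemiGraphs.UniversalCoveringOverTempered
import Literature.AnabelianGeometry.SemiGraphs.TemperedCoveringsComponents
import Literature.AnabelianGeometry.SemiGraphs.TemperedCompactInVerticialFinite
import HarnessLib

/-!
# [SemiAnbd] Thm 3.7 (iii)/(iv) AT THE UNIVERSAL GRAPH-COVERING `𝒢_∞` of a FINITE coherent Thm-3.7 graph —
# the bi-infinite «Tate chain» shape (F-1732 / F-1750 At-forms HOLD there)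

Mochizuki, *Semi-graphs of anabelioids*, Publ. RIMS **42** (2006), §3 p. 38 ("`𝒢_{∞,i} → 𝒢_i` for the
covering of `𝒢_i` determined by the universal graph-covering of the underlying semi-graph `𝔾_i` … the
`𝒢_{∞,i} → 𝒢` are tempered coverings of `𝒢`"), Thm. 3.7 (iii)/(iv) pp. 40–41
[cite: MochizukiSemiAnbd2006, Thm 3.7(iii)(iv) pp.40-41]; the consumer in print is [EtTh] §1–§2, where
Thm. 3.7 / Cor. 3.9 are applied to the infinite chain `Ÿ → Y → X` of coverings of the punctured Tate curve
(universal graph-covering of a dual semi-graph with one vertex and one loop).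

PROOF-ONLY file (cell abc-iut, layer L3, L-F pack A row «CIV@TATE-CHAIN», L3-lead gen 6 β3 (5); seat
abc-iut-w6-d120; no definition, no new named fact).  The cell's ∀-countable typings of Thm 3.7 (iii)
`CompactInVerticial` (F-1732) and (iv) `MaximalCompactIffVerticial` (F-1750) are kernel-refuted at the θ-ray
`𝒢_θ` (an INFINITE, locally finite chain with TWISTED gluings); this file records that at the infinite chains
print actually uses — the covering semi-graphs of anabelioids `𝒢_{∞,F}` of the universal graph-coverings
`F.univCoverOver` over a FINITE coherent Thm-3.7 graph `𝒢` (for the Tate curve: the bi-infinite chain of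
copies of the one vertex group glued cusp-to-cusp along the loop's edge group, each with its open edge) —
BOTH At-forms HOLD, hypothesis-free beyond print's hypotheses on the finite base.  Everything is BY NAME:
abc-iut-L3-d6's route-T heredity `CovObj.routeTInvariant_coveringGraph` (Thm 3.7 (iii) at `𝒢` transfers to
the covering semi-graph of EVERY connected tempered covering object, of any degree), abc-iut-L3-t8's
`compactInVerticialAt_of_finiteGraph` at the finite base, abc-iut-L3-d5's `isConnectedObj_univCoverOverT`
(`𝒢_{∞,F}` is a connected object) and `univCoverOver_isTempered_of_isGaloisCountable` (`𝒢_{∞,F}` is tempered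
for finite `F` over a Galois-countable `𝒢`).

* `univCoverOver_isTempered_of_thm37`, `routeTInvariant_univCoverOver` — for every FINITE covering object
  `F` of a finite coherent Thm-3.7 `𝒢` and base vertex-orbit `V₀`: `𝒢_{∞,F}` satisfies the hypotheses of
  Thm 3.7, is strictly coherent, and satisfies `CompactInVerticialAt`;
* `compactInVerticialAt_univCoverOver`, `maximalCompactIffVerticial_body_univCoverOver` — Thm 3.7 (iii) and
  the body of (iv) at `𝒢_{∞,F}`, every chart;
* the ONE-SHEETED case `F := trivialCov 𝒢 PUnit` (`𝒢_∞` proper, the universal graph-covering of `𝔾` itself: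
  for the Tate dual graph, the chain `Y`): `compactInVerticialAt_univCover`,
  `maximalCompactIffVerticial_body_univCover`.

ERRATUM PICTURE (kernel): the failure of the ∀-countable forms is NOT about infinitude or local finiteness
of `𝔾` as such — every `𝒢_{∞,F}` above is an infinite locally finite semi-graph of anabelioids as soon as
`𝔾` has a cycle — but about coverings: universal graph-coverings of finite coherent Thm-3.7 graphs inherit
(iii)/(iv), the twisted ray `𝒢_θ` is no such covering.  Nothing here asserts Thm 3.7 (iii) for an arbitrary
countable `𝔾`; nothing here takes a side on [IUTchIII] Cor. 3.12; typed ≠ proved.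
-/

namespace Literature.AnabelianGeometry.SemiGraphs

namespace ProfiniteSemiGraph

open CategoryTheory Topology
open Literature.AlgebraicGeometry.Frobenioids (IsConnectedObj)

universe u

variable {𝒢 : ProfiniteSemiGraph.{u}}

namespace CovObj

variable (F : CovObj 𝒢)

/-! ### `𝒢_{∞,F}` over a finite coherent Thm-3.7 graph: tempered, connected, and carrying route T's invariant -/

/-- `𝒢_{∞,F} → 𝒢` is tempered for every FINITE covering object `F` of a graph satisfying the hypotheses of
Thm 3.7 (Galois-countability, [IUTchI] Rmk. 2.5.3 (i) (T2), is part of the bundle).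
[cite: MochizukiSemiAnbd2006, Prop 3.6 p.38] -/
theorem univCoverOver_isTempered_of_thm37 (h37 : 𝒢.Thm37Hypotheses) (hF : F.IsFinite) (V₀ : F.OVertex) :
    (F.univCoverOver (Sum.inl V₀) h37.isCountable).IsTempered :=
  CovObj.univCoverOver_isTempered_of_isGaloisCountable F (Sum.inl V₀) h37.isCountable h37.isGaloisCountable hF

/-- **Route T's invariant at `𝒢_{∞,F}`**: for a FINITE coherent semi-graph of anabelioids `𝒢` satisfying
the hypotheses of Thm 3.7 and a finite covering object `F` with a vertex-orbit `V₀`, the covering semi-graph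
of anabelioids of the universal graph-covering `𝒢_{∞,F} → 𝒢` satisfies the hypotheses of Thm 3.7, is
strictly coherent, and satisfies Thm 3.7 (iii) AT the graph (`CompactInVerticialAt`) — `routeTInvariant_coveringGraph`
at the connected (`isConnectedObj_univCoverOverT`) tempered object `𝒢_{∞,F}`, started from
`compactInVerticialAt_of_finiteGraph`. [cite: MochizukiSemiAnbd2006, Thm 3.7(iii) pp.40-41] -/
theorem routeTInvariant_univCoverOver [Finite 𝒢.graph.Vertex] [Finite 𝒢.graph.Edge]
    (h37 : 𝒢.Thm37Hypotheses) (hcoh : 𝒢.IsCoherent) (hF : F.IsFinite) (V₀ : F.OVertex) :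
    (F.univCoverOver (Sum.inl V₀) h37.isCountable).coveringGraph.Thm37Hypotheses ∧
      (F.univCoverOver (Sum.inl V₀) h37.isCountable).coveringGraph.IsStrictlyCoherent ∧
      CompactInVerticialAt (F.univCoverOver (Sum.inl V₀) h37.isCountable).coveringGraph :=
  have hT := F.univCoverOver_isTempered_of_thm37 h37 hF V₀
  (F.univCoverOver (Sum.inl V₀) h37.isCountable).routeTInvariant_coveringGraph h37
    (isStrictlyCoherent_of_finite ⟨‹_›, ‹_›⟩ hcoh) compactInVerticialAt_of_finiteGraph hT
    (isConnectedObj_univCoverOverT F V₀ h37.isCountable hT)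

/-- **[SemiAnbd] Thm 3.7 (iii) AT `𝒢_{∞,F}`** (F-1732 instance form at the universal graph-covering of a
finite coherent Thm-3.7 graph over a finite covering object): every compact subgroup of `π₁^temp(𝒢_{∞,F})`
lies in a verticial subgroup, a nontrivial one in at most two, and then in an edge-like subgroup of a closed
edge — every chart. [cite: MochizukiSemiAnbd2006, Thm 3.7(iii) pp.40-41] -/
theorem compactInVerticialAt_univCoverOver [Finite 𝒢.graph.Vertex] [Finite 𝒢.graph.Edge]
    (h37 : 𝒢.Thm37Hypotheses) (hcoh : 𝒢.IsCoherent) (hF : F.IsFinite) (V₀ : F.OVertex) :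
    CompactInVerticialAt (F.univCoverOver (Sum.inl V₀) h37.isCountable).coveringGraph :=
  (F.routeTInvariant_univCoverOver h37 hcoh hF V₀).2.2

/-- **[SemiAnbd] Thm 3.7 (iv) AT `𝒢_{∞,F}`, its body in every chart** (F-1750 instance form): the maximal
compact subgroups of `π₁^temp(𝒢_{∞,F})` are exactly the verticial subgroups, and the nontrivial
intersections of two distinct maximal compact subgroups are exactly the edge-like subgroups of closed edges.
[cite: MochizukiSemiAnbd2006, Thm 3.7(iv) p.41] -/
theorem maximalCompactIffVerticial_body_univCoverOver [Finite 𝒢.graph.Vertex] [Finite 𝒢.graph.Edge]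
    (h37 : 𝒢.Thm37Hypotheses) (hcoh : 𝒢.IsCoherent) (hF : F.IsFinite) (V₀ : F.OVertex)
    (c : TemperedPiChart (F.univCoverOver (Sum.inl V₀) h37.isCountable).coveringGraph) :
    (∀ K : Subgroup c.G, IsMaximalCompactSubgroup K ↔ ∃ w, K ∈ verticialSubgroups c w) ∧
    ∀ L : Subgroup c.G, L ≠ ⊥ →
      ((∃ K₁ K₂ : Subgroup c.G, IsMaximalCompactSubgroup K₁ ∧ IsMaximalCompactSubgroup K₂ ∧
          K₁ ≠ K₂ ∧ L = K₁ ⊓ K₂) ↔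
        ∃ e, (F.univCoverOver (Sum.inl V₀) h37.isCountable).coveringGraph.graph.IsClosedEdge e ∧
          L ∈ edgeLikeSubgroups c e) :=
  have hT := F.univCoverOver_isTempered_of_thm37 h37 hF V₀
  (F.univCoverOver (Sum.inl V₀) h37.isCountable).maximalCompactIffVerticialAt_of_routeTInvariant
    (routeTInvariant_of_finite h37 hcoh) hT (isConnectedObj_univCoverOverT F V₀ h37.isCountable hT) c

/-- Thm 3.7 (iv) AT `𝒢_{∞,F}` in the `At`-predicate currency (`MaximalCompactIffVerticialAt`).
[cite: MochizukiSemiAnbd2006, Thm 3.7(iv) p.41] -/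
theorem maximalCompactIffVerticialAt_univCoverOver [Finite 𝒢.graph.Vertex] [Finite 𝒢.graph.Edge]
    (h37 : 𝒢.Thm37Hypotheses) (hcoh : 𝒢.IsCoherent) (hF : F.IsFinite) (V₀ : F.OVertex) :
    MaximalCompactIffVerticialAt (F.univCoverOver (Sum.inl V₀) h37.isCountable).coveringGraph :=
  maximalCompactIffVerticialAt_of_compactInVerticialAt (F.compactInVerticialAt_univCoverOver h37 hcoh hF V₀)

end CovObj

/-! ### The one-sheeted case: the universal graph-covering `𝒢_∞` of `𝔾` itself (the Tate chain `Y → X`) -/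

/-- The one-sheeted trivial covering of a graph with a vertex has a vertex-orbit (a base point for `𝒢_∞`;
e.g. `Quot.mk _ ⟨v, PUnit.unit⟩`). [cite: MochizukiSemiAnbd2006, Def 3.5(i) p.37] -/
theorem nonempty_oVertex_trivialCov_punit (hv : 𝒢.HasVertex) :
    Nonempty (CovObj.trivialCov 𝒢 PUnit.{u + 1}).OVertex := by
  obtain ⟨v⟩ := hv
  exact ⟨Quot.mk _ ⟨v, PUnit.unit⟩⟩

/-- **[SemiAnbd] Thm 3.7 (iii) AT the universal graph-covering `𝒢_∞` of a finite coherent Thm-3.7 graph**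
(`𝒢_∞ := 𝒢_{∞,F}` for the one-sheeted `F`, based at any vertex-orbit `V₀`, e.g. `Quot.mk _ ⟨v, PUnit.unit⟩`): `CompactInVerticialAt` holds there —
for the dual graph of the Tate curve (one vertex, one loop, one cusp) this is the bi-infinite chain `Y` of
[EtTh] §1. [cite: MochizukiSemiAnbd2006, Thm 3.7(iii) pp.40-41] -/
theorem compactInVerticialAt_univCover [Finite 𝒢.graph.Vertex] [Finite 𝒢.graph.Edge]
    (h37 : 𝒢.Thm37Hypotheses) (hcoh : 𝒢.IsCoherent)
    (V₀ : (CovObj.trivialCov 𝒢 PUnit.{u + 1}).OVertex) :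
    CompactInVerticialAt
      ((CovObj.trivialCov 𝒢 PUnit.{u + 1}).univCoverOver (Sum.inl V₀)
        h37.isCountable).coveringGraph :=
  (CovObj.trivialCov 𝒢 PUnit.{u + 1}).compactInVerticialAt_univCoverOver h37 hcoh
    (CovObj.trivialCov_punit_isFinite 𝒢) _

/-- **[SemiAnbd] Thm 3.7 (iv) AT the universal graph-covering `𝒢_∞` of a finite coherent Thm-3.7 graph**
(`At`-predicate form). [cite: MochizukiSemiAnbd2006, Thm 3.7(iv) p.41] -/
theorem maximalCompactIffVerticialAt_univCover [Finite 𝒢.graph.Vertex] [Finite 𝒢.graph.Edge]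
    (h37 : 𝒢.Thm37Hypotheses) (hcoh : 𝒢.IsCoherent)
    (V₀ : (CovObj.trivialCov 𝒢 PUnit.{u + 1}).OVertex) :
    MaximalCompactIffVerticialAt
      ((CovObj.trivialCov 𝒢 PUnit.{u + 1}).univCoverOver (Sum.inl V₀)
        h37.isCountable).coveringGraph :=
  (CovObj.trivialCov 𝒢 PUnit.{u + 1}).maximalCompactIffVerticialAt_univCoverOver h37 hcoh
    (CovObj.trivialCov_punit_isFinite 𝒢) _

/-- The hypotheses of Thm 3.7 and strict coherence also hold at `𝒢_∞` (so the At-forms above are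
statements about a genuine Thm-3.7 graph, and towers may be continued from it).
[cite: MochizukiSemiAnbd2006, Thm 3.7 p.40] -/
theorem thm37Hypotheses_univCover [Finite 𝒢.graph.Vertex] [Finite 𝒢.graph.Edge]
    (h37 : 𝒢.Thm37Hypotheses) (hcoh : 𝒢.IsCoherent)
    (V₀ : (CovObj.trivialCov 𝒢 PUnit.{u + 1}).OVertex) :
    ((CovObj.trivialCov 𝒢 PUnit.{u + 1}).univCoverOver (Sum.inl V₀)
        h37.isCountable).coveringGraph.Thm37Hypotheses ∧
      ((CovObj.trivialCov 𝒢 PUnit.{u + 1}).univCoverOver (Sum.inl V₀)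
        h37.isCountable).coveringGraph.IsStrictlyCoherent :=
  let h := (CovObj.trivialCov 𝒢 PUnit.{u + 1}).routeTInvariant_univCoverOver h37 hcoh
    (CovObj.trivialCov_punit_isFinite 𝒢) V₀
  ⟨h.1, h.2.1⟩

end ProfiniteSemiGraph

end Literature.AnabelianGeometry.SemiGraphs
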